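/-
Copyright (c) 2026. All rights reserved.
Released under Apache 2.0 license as described in the file LICENSE.
Authors: abc-iut cell, prover seat abc-iut-f-101 (gen 5; row «SB′-D2», abc-iut-L4-lead m136), over abc-iut-w5-d144's
`DiagramChainFamiliesTwoSided.lean` (two-sided chain families) and abc-iut-L4-t15's `DiagramTelecorePaths.lean` (pattern of
the last-visit decomposition).
-/
import Literature.AnabelianGeometry.AbsoluteAnabelian.DiagramChainFamiliesTwoSided
import Literature.AnabelianGeometry.AbsoluteAnabelian.DiagramTelecoreFamilies

/-!
# Families of homotopies generated by a SYSTEM OF SINK FAMILIES ([AbsTopIII] Def. 3.5 (ii)–(iv), toolkit)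

S. Mochizuki, *Topics in Absolute Anabelian Geometry III*, §0 p. 26 (saturated sets of co-verticial pairs), Def. 3.5 (ii)
p. 75 (families of homotopies; "compatible" families = contained in ONE family with the same homotopies), (iii) p. 75
(observables: all boundary paths END at the observation vertex), (iv) p. 76 (telecores: boundary pairs
`([γ₃]∘[γ₁], [γ₃]∘[γ₂])`), kurims manuscript `paper:url-5493eb38cbb7`, bib key `MochizukiAbsTopIII2015`.

The compatibility assertions of [AbsTopIII] Cor 5.5 (iii) / Cor 5.10 (iv)(b)(c) ask for ONE family of homotopies on a
(telecore) diagram containing SEVERAL families each of which is concentrated on pairs of paths INTO one vertex (the core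
family at the core vertex, the observables `S_log⊞_v` at `𝒩⊞_v`, `S_log_v` at `𝒩_v`), post-whiskered arbitrarily.  This file
isolates the combinatorics:

* a **sink system** (`SinkSystem D isObs`) on a diagram of categories `𝒟`: a set of FLAGGED vertices (`isObs`), and on the
  co-verticial pairs of paths INTO flagged vertices a pre-family of homotopies (`E`, `η`) with the identity on diagonal members
  (`η_self`), composition (`trans`), PRE-whiskering (`precomp`) and — the one interaction axiom — **PUSH-FORWARD**: a member
  pair into a flagged `n` post-composed with ANY path `n ⟶ n'` into a flagged `n'` is a member pair at `n'`, with the whiskered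
  homotopy (`push`);
* the two-sided chain family generated by all member pairs (abc-iut-w5-d144's `chainFamily₂`) is then COHERENT
  (`SinkSystem.thin`): every move of a chain is projected to the LAST flagged vertex visited by the path (`lastVisit`, the
  `Bool`-flag analogue of abc-iut-L4-t15's `ExtShape.lastSplit`), where — by `precomp` + `push` — it is a member pair whiskered
  by the common flag-free tail (`SinkSystem.move_project`), so that a whole chain composes inside ONE sink pre-family
  (`SinkSystem.chain_project`);
* `SinkSystem.family` — the resulting family of homotopies (Def. 3.5 (ii)); `family_η_of_mem` (a member pair is a boundary
  pair with its own homotopy), `family_η_tail` (… and so is its post-whiskering by any tail, with the whiskered homotopy —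
  the shape of a telecore pair, Def. 3.5 (iv) (b)).

Consumer: `LogFrobeniusMonoTelecoreObservablesOf.lean` (Cor 5.10 (iv)(b), last sentence: flagged vertices `An⊢[𝒩⊢⊞]`,
`𝒩⊞_v`, `𝒩_v` of the telecore diagram `D_{An⊢}`).  Pure category theory; every declaration cites the item of
§0 / Def. 3.5 whose bookkeeping they are.  Nothing here bears on [IUTchIII] Cor. 3.12.
-/

set_option autoImplicit false

namespace Literature.AnabelianGeometry.AbsoluteAnabelian

open _root_.CategoryTheory _root_.Quiver

universe v u w

namespace DiagramOfCategories

variable {V : Type w} [Quiver.{v} V]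

/-! ## The last visit of a flagged vertex -/

section LastVisit

variable (isObs : V → Bool)

/-- A decomposition `γ = τ ∘ γ₀` of a path at a vertex `n`: the prefix `γ₀ : a ⟶ n` and the tail `τ : n ⟶ b`
(the shape `([γ₃]∘[γ₁], [γ₃]∘[γ₂])` of Def. 3.5 (iv) (b)). [cite: MochizukiAbsTopIII2015, Definition 3.5 (iv) p.76] -/
structure Split (a b : V) : Type (max v w) where
  /-- the intermediate vertex -/
  n : V
  /-- the prefix into it -/
  pre : Path a n
  /-- the tail out of it -/
  tail : Path n b

/-- The decomposition of a path at its LAST visit of a flagged vertex (prefix into the last flagged vertex, flag-free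
tail), if it visits one — structural recursion on the path, deciding the flag of each vertex met from the end
(abc-iut-L4-t15's `lastSplit` for a `Bool`-valued flag instead of the observation vertex). [cite: MochizukiAbsTopIII2015, Definition 3.5 (iv) p.76] -/
def lastVisit {a : V} : ∀ {b : V}, Path a b → Option (Split a b)
  | _, Path.nil => if isObs a = true then some ⟨a, Path.nil, Path.nil⟩ else none
  | b, Path.cons p e =>
      if isObs b = true then some ⟨b, p.cons e, Path.nil⟩
      else (lastVisit p).map fun s => ⟨s.n, s.pre, s.tail.cons e⟩

/-- A path ending at a flagged vertex splits trivially there. [cite: MochizukiAbsTopIII2015, Definition 3.5 (iv) p.76] -/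
theorem lastVisit_of_isObs {a b : V} (p : Path a b) (hb : isObs b = true) :
    lastVisit isObs p = some ⟨b, p, Path.nil⟩ := by
  cases p with
  | nil => simp [lastVisit, hb]
  | cons p e => simp [lastVisit, hb]

/-- The split of a path extended by an edge into an unflagged vertex. [cite: MochizukiAbsTopIII2015, Definition 3.5 (iv) p.76] -/
theorem lastVisit_cons_of_not {a b c : V} (p : Path a b) (e : b ⟶ c) (hc : isObs c = false) :
    lastVisit isObs (p.cons e) = (lastVisit isObs p).map fun s => ⟨s.n, s.pre, s.tail.cons e⟩ := by
  simp [lastVisit, hc]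

/-- A split recomposes to the path, and its vertex is flagged. [cite: MochizukiAbsTopIII2015, Definition 3.5 (iv) p.76] -/
theorem eq_comp_of_lastVisit {a : V} : ∀ {b : V} (p : Path a b) {s : Split a b},
    lastVisit isObs p = some s → p = s.pre.comp s.tail ∧ isObs s.n = true
  | _, Path.nil, s, h => by
    by_cases ha : isObs a = true
    · simp only [lastVisit, ha, ↓reduceIte, Option.some.injEq] at h
      subst h
      exact ⟨rfl, ha⟩
    · simp [lastVisit, ha] at h
  | b, Path.cons p e, s, h => by
    by_cases hb : isObs b = true
    · simp only [lastVisit, hb, ↓reduceIte, Option.some.injEq] at h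
      subst h
      exact ⟨rfl, hb⟩
    · have hb' : isObs b = false := by simpa using hb
      rw [lastVisit_cons_of_not isObs p e hb'] at h
      obtain ⟨s', hs', rfl⟩ := Option.map_eq_some_iff.mp h
      obtain ⟨hp, hn⟩ := eq_comp_of_lastVisit p hs'
      exact ⟨by change p.cons e = (s'.pre.comp s'.tail).cons e; rw [← hp], hn⟩

/-- A path out of a flagged vertex visits a flagged vertex. [cite: MochizukiAbsTopIII2015, Definition 3.5 (iv) p.76] -/
theorem exists_lastVisit_of_isObs_source {n : V} (hn : isObs n = true) :
    ∀ {b : V} (r : Path n b), ∃ s, lastVisit isObs r = some s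
  | _, Path.nil => ⟨⟨n, Path.nil, Path.nil⟩, by simp [lastVisit, hn]⟩
  | b, Path.cons r e => by
    by_cases hb : isObs b = true
    · exact ⟨_, lastVisit_of_isObs isObs _ hb⟩
    · have hb' : isObs b = false := by simpa using hb
      obtain ⟨s, hs⟩ := exists_lastVisit_of_isObs_source hn r
      exact ⟨⟨s.n, s.pre, s.tail.cons e⟩, by rw [lastVisit_cons_of_not isObs r e hb', hs]; rfl⟩

/-- The split of `r ∘ γ₀` for `γ₀` INTO a flagged vertex is the split of `r` with `γ₀` prepended: it depends on `r` only
(the last flagged vertex of the composite lies on `r`). [cite: MochizukiAbsTopIII2015, Definition 3.5 (iv) p.76] -/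
theorem lastVisit_comp {a n : V} (p : Path a n) (hn : isObs n = true) :
    ∀ {b : V} (r : Path n b),
      lastVisit isObs (p.comp r) = (lastVisit isObs r).map fun s => ⟨s.n, p.comp s.pre, s.tail⟩
  | _, Path.nil => by
    rw [Path.comp_nil, lastVisit_of_isObs isObs p hn]
    simp [lastVisit, hn]
  | b, Path.cons r e => by
    by_cases hb : isObs b = true
    · rw [Path.comp_cons, lastVisit_of_isObs isObs _ hb, lastVisit_of_isObs isObs _ hb]
      rfl
    · have hb' : isObs b = false := by simpa using hb
      rw [Path.comp_cons, lastVisit_cons_of_not isObs _ e hb', lastVisit_cons_of_not isObs _ e hb', lastVisit_comp p hn r,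
        Option.map_map, Option.map_map]
      rfl

/-- The split of a path presented as `τ ∘ γ ∘ ρ` with `γ` ending at a FLAGGED vertex `d`: it is read off the split of the
tail `τ` (which exists, `τ` starting at `d`). [cite: MochizukiAbsTopIII2015, Definition 3.5 (iv) p.76] -/
theorem lastVisit_of_eq_comp₂ {a c d b : V} {p : Path a b} (r : Path a c) (g : Path c d) (t : Path d b)
    (hd : isObs d = true) (hp : p = (r.comp g).comp t) {st : Split d b} (hst : lastVisit isObs t = some st) :
    lastVisit isObs p = some ⟨st.n, (r.comp g).comp st.pre, st.tail⟩ := by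
  rw [hp, lastVisit_comp isObs (r.comp g) hd t, hst]
  rfl

end LastVisit

/-! ## Whiskering a homotopy of a pair into a vertex by a common tail -/

section TailHom

variable (D : DiagramOfCategories.{v, u, w} V)

/-- The homotopy `ζ ▹ 𝒟_[τ] : 𝒟_[τ ∘ γ₁] ⟶ 𝒟_[τ ∘ γ₂]` of a pair whiskered by a common tail (Def. 3.5 (ii), third axiom with
trivial prefix), on paths given by equations. [cite: MochizukiAbsTopIII2015, Definition 3.5 (ii) p.75] -/
noncomputable def tailHom {a n b : V} {P₀ Q₀ : Path a n} (θ : D.pathFunctor P₀ ⟶ D.pathFunctor Q₀) (t : Path n b)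
    {P Q : Path a b} (hP : P = P₀.comp t) (hQ : Q = Q₀.comp t) : D.pathFunctor P ⟶ D.pathFunctor Q :=
  eqToHom (D.pathFunctor_eq_of_eq_comp P₀ t hP) ≫ Functor.whiskerRight θ (D.pathFunctor t) ≫
    eqToHom (D.pathFunctor_eq_of_eq_comp Q₀ t hQ).symm

/-- Its components (plain objects). [cite: MochizukiAbsTopIII2015, Definition 3.5 (ii) p.75] -/
theorem tailHom_app {a n b : V} {P₀ Q₀ : Path a n} (θ : D.pathFunctor P₀ ⟶ D.pathFunctor Q₀) (t : Path n b)
    {P Q : Path a b} (hP : P = P₀.comp t) (hQ : Q = Q₀.comp t) (x : D.obj a) :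
    (D.tailHom θ t hP hQ).app x =
      eqToHom (D.pathFunctor_obj_of_eq_comp P₀ t hP x) ≫ (D.pathFunctor t).map (θ.app x) ≫
        eqToHom (D.pathFunctor_obj_of_eq_comp Q₀ t hQ x).symm := by
  subst hP hQ
  simp only [tailHom, NatTrans.comp_app, eqToHom_app, Functor.whiskerRight_app]
  rfl

/-- Whiskering by a common tail is compatible with composition. [cite: MochizukiAbsTopIII2015, Definition 3.5 (ii) p.75] -/
theorem tailHom_comp {a n b : V} {P₀ Q₀ R₀ : Path a n} (θ : D.pathFunctor P₀ ⟶ D.pathFunctor Q₀)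
    (θ' : D.pathFunctor Q₀ ⟶ D.pathFunctor R₀) (t : Path n b) {P Q R : Path a b} (hP : P = P₀.comp t)
    (hQ : Q = Q₀.comp t) (hR : R = R₀.comp t) :
    D.tailHom θ t hP hQ ≫ D.tailHom θ' t hQ hR = D.tailHom (θ ≫ θ') t hP hR := by
  ext x
  simp only [NatTrans.comp_app, tailHom_app, Functor.map_comp, Category.assoc, eqToHom_trans_assoc, eqToHom_refl,
    Category.id_comp]

/-- Whiskering the identity gives the identity. [cite: MochizukiAbsTopIII2015, Definition 3.5 (ii) p.75] -/
theorem tailHom_id {a n b : V} {P₀ : Path a n} (t : Path n b) {P : Path a b} (hP : P = P₀.comp t) :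
    D.tailHom (𝟙 (D.pathFunctor P₀)) t hP hP = 𝟙 _ := by
  ext x
  simp only [tailHom_app, NatTrans.id_app, Functor.map_id, Category.id_comp, eqToHom_trans, eqToHom_refl]

/-- A two-sided move homotopy whose generator homotopy is itself a pre-whiskered homotopy pushed along a path is the
tail-whiskering of that composite description (bookkeeping: `𝒟_[ρ] ◁ ζ ▹ 𝒟_[σ ∘ π] = (𝒟_[ρ] ◁ ζ ▹ 𝒟_[π]) ▹ 𝒟_[σ]`),
componentwise. [cite: MochizukiAbsTopIII2015, Definition 3.5 (ii) p.75] -/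
theorem moveHom₂_app_eq_tailHom_app {a c d n b : V} (r : Path a c) {g g' : Path c d}
    (α : D.pathFunctor g ⟶ D.pathFunctor g') (pre : Path d n) (tail : Path n b) {p p' : Path a b}
    (hp : p = (r.comp g).comp (pre.comp tail)) (hp' : p' = (r.comp g').comp (pre.comp tail))
    {P₀ P₀' : Path a n} (hP₀ : P₀ = (r.comp g).comp pre) (hP₀' : P₀' = (r.comp g').comp pre)
    (θ : D.pathFunctor P₀ ⟶ D.pathFunctor P₀')
    (hθ : ∀ x, θ.app x = eqToHom (D.pathFunctor_obj_of_eq_comp₂ r g pre hP₀ x) ≫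
      (D.pathFunctor pre).map (α.app ((D.pathFunctor r).obj x)) ≫
        eqToHom (D.pathFunctor_obj_of_eq_comp₂ r g' pre hP₀' x).symm)
    (hP : p = P₀.comp tail) (hP' : p' = P₀'.comp tail) (x : D.obj a) :
    (D.moveHom₂ r α (pre.comp tail) hp hp').app x = (D.tailHom θ tail hP hP').app x := by
  rw [moveHom₂_app, tailHom_app, hθ, D.pathFunctor_comp_map pre tail]
  simp only [Functor.map_comp, eqToHom_map, Category.assoc, eqToHom_trans, eqToHom_trans_assoc]

end TailHom

/-! ## Sink systems -/

/-- **A system of sink families** on `𝒟`: flagged vertices `isObs`, and on the co-verticial pairs of paths INTO flagged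
vertices a set of member pairs `E` with homotopies `η` (Def. 3.5 (ii) (b)) such that: the homotopy of a diagonal member is
the identity (`η_self`); member pairs compose, with composite homotopy (`trans`); member pairs are stable under
PRE-composition with any path, with the pre-whiskered homotopy (`precomp`, Def. 3.5 (ii) third axiom); and
**push-forward**: a member pair at a flagged `n` POST-composed with any path into a flagged `n'` is a member pair at `n'` with
the post-whiskered homotopy (`push` — the interaction of the several sink families; for a single observable it is vacuous,
for a telecore it is the clause `([γ₃]∘[γ₁], [γ₃]∘[γ₂])` of Def. 3.5 (iv) (b) read at the next flagged vertex).
[cite: MochizukiAbsTopIII2015, Definition 3.5 (ii) p.75] -/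
structure SinkSystem (D : DiagramOfCategories.{v, u, w} V) (isObs : V → Bool) where
  /-- member pairs (into flagged vertices only, `mem_isObs`) -/
  E : ∀ ⦃a n : V⦄, Path a n → Path a n → Prop
  mem_isObs : ∀ ⦃a n : V⦄ ⦃p q : Path a n⦄, E p q → isObs n = true
  /-- the homotopy of a member pair -/
  η : ∀ ⦃a n : V⦄ ⦃p q : Path a n⦄, E p q → (D.pathFunctor p ⟶ D.pathFunctor q)
  η_self : ∀ ⦃a n : V⦄ ⦃p : Path a n⦄ (h : E p p), η h = 𝟙 _
  trans : ∀ ⦃a n : V⦄ ⦃p q r : Path a n⦄ (h₁ : E p q) (h₂ : E q r), ∃ h₃ : E p r, η h₃ = η h₁ ≫ η h₂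
  precomp : ∀ ⦃c a n : V⦄ ⦃p q : Path a n⦄ (h : E p q) (r : Path c a), ∃ h' : E (r.comp p) (r.comp q),
    ∀ x : D.obj c, (η h').app x = eqToHom (D.pathFunctor_comp_obj r p x) ≫ (η h).app ((D.pathFunctor r).obj x) ≫
      eqToHom (D.pathFunctor_comp_obj r q x).symm
  push : ∀ ⦃a n n' : V⦄ ⦃p q : Path a n⦄ (h : E p q) (s : Path n n'), isObs n' = true →
    ∃ h' : E (p.comp s) (q.comp s), ∀ x : D.obj a,
      (η h').app x = eqToHom (D.pathFunctor_comp_obj p s x) ≫ (D.pathFunctor s).map ((η h).app x) ≫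
        eqToHom (D.pathFunctor_comp_obj q s x).symm

namespace SinkSystem

variable {D : DiagramOfCategories.{v, u, w} V} {isObs : V → Bool} (S : SinkSystem D isObs)

/-- The generators of the family: the member pairs. [cite: MochizukiAbsTopIII2015, Definition 3.5 (ii) p.75] -/
abbrev Gen ⦃c d : V⦄ (g g' : Path c d) : Type := PLift (S.E g g')

/-- Their homotopies. [cite: MochizukiAbsTopIII2015, Definition 3.5 (ii) p.75] -/
def genHom ⦃c d : V⦄ ⦃g g' : Path c d⦄ (s : S.Gen g g') : D.pathFunctor g ⟶ D.pathFunctor g' := S.η s.down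

/-- A member pair pre-composed with `ρ` and post-composed with `π` into a flagged vertex is a member pair whose homotopy is
`𝒟_[ρ] ◁ ζ ▹ 𝒟_[π]`, componentwise (`precomp` then `push`). [cite: MochizukiAbsTopIII2015, Definition 3.5 (ii) p.75] -/
theorem mem_whisker {a c d n : V} (r : Path a c) {g g' : Path c d} (h : S.E g g') (pre : Path d n) (hn : isObs n = true) :
    ∃ h' : S.E ((r.comp g).comp pre) ((r.comp g').comp pre), ∀ x : D.obj a,
      (S.η h').app x = eqToHom (D.pathFunctor_obj_of_eq_comp₂ r g pre rfl x) ≫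
        (D.pathFunctor pre).map ((S.η h).app ((D.pathFunctor r).obj x)) ≫
          eqToHom (D.pathFunctor_obj_of_eq_comp₂ r g' pre rfl x).symm := by
  obtain ⟨h₁, hη₁⟩ := S.precomp h r
  obtain ⟨h₂, hη₂⟩ := S.push h₁ pre hn
  refine ⟨h₂, fun x => ?_⟩
  rw [hη₂ x, hη₁ x]
  simp only [Functor.map_comp, eqToHom_map, Category.assoc, eqToHom_trans, eqToHom_trans_assoc]

/-- **Projection of a move to the last flagged vertex.**  A two-sided move `τ ∘ (γ, γ') ∘ ρ` of member pairs acts on a path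
whose last flagged vertex `n` lies on the tail `τ = τ₂ ∘ τ₁` (`τ₁ : d ⟶ n`, `τ₂` flag-free); the two paths share the split
vertex and the flag-free tail `τ₂`, their prefixes `τ₁ ∘ γ ∘ ρ`, `τ₁ ∘ γ' ∘ ρ` form a MEMBER pair at `n`, and the move's
homotopy is that member's homotopy whiskered by `τ₂`. [cite: MochizukiAbsTopIII2015, Definition 3.5 (ii) p.75] -/
theorem move_project {a b : V} {p p' : Path a b} (m : Move₂ S.Gen p p') :
    ∃ (n : V) (P₀ P₀' : Path a n) (tail : Path n b) (hP : p = P₀.comp tail) (hP' : p' = P₀'.comp tail)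
      (h : S.E P₀ P₀'),
      lastVisit isObs p = some ⟨n, P₀, tail⟩ ∧ lastVisit isObs p' = some ⟨n, P₀', tail⟩ ∧
        m.hom S.genHom = D.tailHom (S.η h) tail hP hP' := by
  have hd : isObs m.d = true := S.mem_isObs m.s.down
  obtain ⟨st, hst⟩ := exists_lastVisit_of_isObs_source isObs hd m.t
  obtain ⟨ht, hn⟩ := eq_comp_of_lastVisit isObs m.t hst
  obtain ⟨h, hη⟩ := S.mem_whisker m.r m.s.down st.pre hn
  have hP : p = ((m.r.comp m.g).comp st.pre).comp st.tail := by rw [Path.comp_assoc, ← ht]; exact m.hp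
  have hP' : p' = ((m.r.comp m.g').comp st.pre).comp st.tail := by rw [Path.comp_assoc, ← ht]; exact m.hp'
  refine ⟨st.n, (m.r.comp m.g).comp st.pre, (m.r.comp m.g').comp st.pre, st.tail, hP, hP', h,
    lastVisit_of_eq_comp₂ isObs m.r m.g m.t hd m.hp hst, lastVisit_of_eq_comp₂ isObs m.r m.g' m.t hd m.hp' hst, ?_⟩
  ext x
  have hp₁ : p = (m.r.comp m.g).comp (st.pre.comp st.tail) := by rw [← ht]; exact m.hp
  have hp₁' : p' = (m.r.comp m.g').comp (st.pre.comp st.tail) := by rw [← ht]; exact m.hp'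
  have key := D.moveHom₂_app_eq_tailHom_app m.r (S.genHom m.s) st.pre st.tail hp₁ hp₁' rfl rfl (S.η h) hη hP hP' x
  rw [← key]
  -- the move's homotopy does not depend on the presentation of its tail
  change (D.moveHom₂ m.r (S.genHom m.s) m.t m.hp m.hp').app x = _
  rw [moveHom₂_app, moveHom₂_app]
  have e : D.pathFunctor m.t = D.pathFunctor (st.pre.comp st.tail) := by rw [← ht]
  rw [Functor.congr_hom e]
  simp only [Category.assoc, eqToHom_trans, eqToHom_trans_assoc]

/-- **Projection of a chain.**  Along a chain of moves of member pairs starting at a path that visits a flagged vertex, all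
paths share the last flagged vertex and the flag-free tail, and the chain's homotopy is EITHER trivial (no move) OR the
homotopy of ONE member pair at that vertex (the composite inside the sink pre-family, `trans`) whiskered by the tail.
[cite: MochizukiAbsTopIII2015, Definition 3.5 (ii) p.75] -/
theorem chain_project {a b : V} {p q : Path a b} (c : Chain₂ S.Gen p q) :
    ∀ {n : V} {P₀ : Path a n} {tail : Path n b}, lastVisit isObs p = some ⟨n, P₀, tail⟩ →
      ∃ (Q₀ : Path a n) (hP : p = P₀.comp tail) (hQ : q = Q₀.comp tail), lastVisit isObs q = some ⟨n, Q₀, tail⟩ ∧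
        ((∃ e : p = q, c.hom S.genHom = eqToHom (by rw [e])) ∨
          ∃ h : S.E P₀ Q₀, c.hom S.genHom = D.tailHom (S.η h) tail hP hQ) := by
  induction c with
  | nil p =>
    intro n P₀ tail hp
    obtain ⟨hP, -⟩ := eq_comp_of_lastVisit isObs p hp
    exact ⟨P₀, hP, hP, hp, Or.inl ⟨rfl, by simp⟩⟩
  | cons m rest ih =>
    intro n P₀ tail hp
    obtain ⟨n₁, P₁, P₁', tail₁, hP₁, hP₁', h₁, hlv, hlv', hm⟩ := S.move_project m
    rw [hp] at hlv
    cases hlv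
    obtain ⟨Q₀, hP', hQ, hlq, hrest⟩ := ih hlv'
    refine ⟨Q₀, hP₁, hQ, hlq, Or.inr ?_⟩
    rcases hrest with ⟨e, he⟩ | ⟨h₂, he⟩
    · subst e
      cases Path.comp_injective_left _ (hP₁'.symm.trans hQ)
      refine ⟨h₁, ?_⟩
      rw [Chain₂.hom_cons, hm, he]
      simp only [eqToHom_refl, Category.comp_id]
    · obtain ⟨h₃, hη₃⟩ := S.trans h₁ h₂
      refine ⟨h₃, ?_⟩
      rw [Chain₂.hom_cons, hm, he, tailHom_comp, ← hη₃]

/-- **Coherence of a sink system**: any two chains of two-sided moves of member pairs between the same pair of paths have the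
same homotopy (the hypothesis `thin` of abc-iut-w5-d144's `chainFamily₂`).
[cite: MochizukiAbsTopIII2015, Definition 3.5 (ii) p.75] -/
theorem thin {a b : V} (p q : Path a b) (c c' : Chain₂ S.Gen p q) : c.hom S.genHom = c'.hom S.genHom := by
  cases hlv : lastVisit isObs p with
  | none =>
    -- a path that never visits a flagged vertex admits no move: both chains are empty
    have hnil : ∀ {q' : Path a b} (c₀ : Chain₂ S.Gen p q'), ∃ e : p = q', c₀.hom S.genHom = eqToHom (by rw [e]) := by
      intro q' c₀
      cases c₀ with
      | nil _ => exact ⟨rfl, by simp⟩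
      | cons m rest =>
        obtain ⟨n, P₀, P₀', tail, -, -, -, hl, -⟩ := S.move_project m
        rw [hlv] at hl
        cases hl
    obtain ⟨e, he⟩ := hnil c
    obtain ⟨e', he'⟩ := hnil c'
    rw [he, he']
  | some s =>
    obtain ⟨n, P₀, tail⟩ := s
    obtain ⟨Q₀, hP, hQ, -, hc⟩ := S.chain_project c hlv
    obtain ⟨Q₀', hP', hQ', -, hc'⟩ := S.chain_project c' hlv
    cases Path.comp_injective_left tail (hQ.symm.trans hQ')
    rcases hc with ⟨e, he⟩ | ⟨h, he⟩ <;> rcases hc' with ⟨e', he'⟩ | ⟨h', he'⟩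
    · rw [he, he']
    · subst e
      cases Path.comp_injective_left _ (hP.symm.trans hQ')
      rw [he, he', S.η_self h', tailHom_id]
      simp only [eqToHom_refl]
    · subst e'
      cases Path.comp_injective_left _ (hP'.symm.trans hQ)
      rw [he, he', S.η_self h, tailHom_id]
      simp only [eqToHom_refl]
    · rw [he, he']

/-! ## The family of homotopies of a sink system -/

/-- **The family of homotopies generated by a sink system** (Def. 3.5 (ii)): boundary set = pairs of co-verticial paths joined by
a chain of two-sided whiskered member pairs, homotopy = the composite along any chain (abc-iut-w5-d144's `chainFamily₂`,
coherent by `thin`). [cite: MochizukiAbsTopIII2015, Definition 3.5 (ii) p.75] -/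
noncomputable def family : D.HomotopyFamily := chainFamily₂ D S.Gen S.genHom S.thin

/-- A member pair whiskered by any common tail is a boundary pair of the family, with the whiskered homotopy (the shape of
the telecore pairs `([γ₃]∘[γ₁], [γ₃]∘[γ₂])` of Def. 3.5 (iv) (b), and of an observable's pair post-composed inside a bigger
diagram). [cite: MochizukiAbsTopIII2015, Definition 3.5 (iv) p.76] -/
theorem family_η_tail {a n b : V} {P₀ Q₀ : Path a n} (h : S.E P₀ Q₀) (tail : Path n b) {P Q : Path a b}
    (hP : P = P₀.comp tail) (hQ : Q = Q₀.comp tail) :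
    ∃ h' : S.family.E P Q, S.family.η h' = D.tailHom (S.η h) tail hP hQ := by
  let m : Move₂ S.Gen P Q := ⟨a, n, Path.nil, P₀, Q₀, tail, ⟨h⟩, by rw [Path.nil_comp]; exact hP,
    by rw [Path.nil_comp]; exact hQ⟩
  obtain ⟨h', hη⟩ := chainFamily₂_η_move D S.Gen S.genHom S.thin m
  refine ⟨h', hη.trans ?_⟩
  ext x
  change (D.moveHom₂ Path.nil (S.η h) tail m.hp m.hp').app x = _
  rw [moveHom₂_app, tailHom_app, NatTrans.congr (S.η h) (D.pathFunctor_nil_obj a x)]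
  simp only [Functor.map_comp, eqToHom_map, Category.assoc, eqToHom_trans, eqToHom_trans_assoc]

/-- A member pair is a boundary pair of the family with its own homotopy (Def. 3.5 (ii) "compatible": the sink pre-families
are contained in the generated family). [cite: MochizukiAbsTopIII2015, Definition 3.5 (ii) p.75] -/
theorem family_η_of_mem {a n : V} {P₀ Q₀ : Path a n} (h : S.E P₀ Q₀) :
    ∃ h' : S.family.E P₀ Q₀, S.family.η h' = S.η h := by
  obtain ⟨h', hη⟩ := S.family_η_tail h Path.nil (Path.comp_nil _).symm (Path.comp_nil _).symm
  refine ⟨h', hη.trans ?_⟩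
  ext x
  rw [tailHom_app, D.pathFunctor_nil_map]
  simp only [Category.assoc, eqToHom_trans, eqToHom_trans_assoc, eqToHom_refl, Category.id_comp, Category.comp_id]

/-- The boundary set of the family. [cite: MochizukiAbsTopIII2015, Definition 3.5 (ii) p.75] -/
theorem family_E_iff {a b : V} (p q : Path a b) : S.family.E p q ↔ Nonempty (Chain₂ S.Gen p q) := Iff.rfl

end SinkSystem

end DiagramOfCategories

end Literature.AnabelianGeometry.AbsoluteAnabelian
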